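import Literature.MathematicalPhysics.QuantumFieldTheory.Balaban1983to89.B15Prop1MinimiserFamilyFromRightInverse
import Literature.MathematicalPhysics.QuantumFieldTheory.Balaban1983to89.B16Ineq19FlatSliceChart
import Literature.MathematicalPhysics.QuantumFieldTheory.Balaban1983to89.Node00.LinearisedAveragingAtBackground

/-!
# `Balaban1983to89.B15Prop1RightInverseFromLinearisedAveraging` — [Balaban1985Variational] = «[15]», (3)–(4) p. 278, Sect. C (44)–(48) p. 285 («L^j η Q_j H B = B»);
# [Balaban1989LargeFieldII] = «[LF-II]», (1.19) p. 360; [Balaban1988Convergent] (2.10)–(2.11) p. 256: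
# THE RIGHT-INVERSE LETTER `hH` OF THE w1 LINEAGE FROM A RIGHT INVERSE OF NODE 00's LINEARISED MULTI-SCALE AVERAGING `dIterL` («`Q_k(U₀)`») — the chart dictionary
# «left chart `exp(A)·U₀` = right chart `U₀·exp(Ad_{U₀⁻¹} A)`» and the velocity of the averages along left-chart lines

Honest framing: statement-level skeleton of published theorems with citation tags; proofs where landed; nothing here is a claim about the
Yang–Mills mass gap.  Cell `pub-ymgap`, HUMAN RULING D-0149 (width seats), seat `pub-ymgap-dag-n12-w1` (g2; N12 = [B15]; U1a⁺ of the w1 lineage);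
count-neutral; N12 NOT discharged; finite 𝕋⁴ at fixed ε; nothing continuum ∕ OS ∕ mass-gap ∕ Clay.

WHY.  `B15Prop1MinimiserFamilyFromRightInverse.hMin_[atRecord_]of_rightInverseLetters` (this seat) display, per base field, the REAL RIGHT-INVERSE letter `hH` in VELOCITY currency
along the LEFT chart lines `s ↦ expMul su2Chart (s • p) U₀ = exp(s p̂)·U₀` of the lineage's state chart:
`∀ τ, ∃ p real, cplxVec p ∈ S ∧ ∀ i, HasDerivAt (s ↦ ↑Ū^{j_i}(exp(s p̂)·U₀)(c_i)) (↑W_i · Σ_b τ_{i,b} E_b) 0`.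
NODE 00 (`Node00.LinearisedAveragingAtBackground`, n07-e) owns print's LINEARISED averaging `Q_k(U₀)` as `dIterL k ↑U₀` with the velocity theorem
`hasDerivAt_coe_iter_expChart_smul` along the RIGHT chart `t ↦ U₀·exp(tX)` (`Node00.expChart`), and the (J-b) lane states right inverses in that currency.  THIS MODULE is the
junction: (§1) the chart dictionary `expMul su2Chart A U₀ = expChart U₀ (b ↦ Ad((U₀ b)⁻¹)(φ (A b)))` for ANY base `U₀` (n12-w3∕w4's `expMul_su2Chart_one_eq_expChart` is the case
`U₀ = 1`), with `φ : ℝ³ → 𝔰𝔲(2)` any coordinate (`B16Ineq19FlatSliceChart.exists_lieSU2Coord`); (§2) hence the velocity of `↑Ū^j(exp(s p̂)·U₀)(c)` at `s = 0` IS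
`dIterL j ↑U₀ (b ↦ (Σ_a p_{b,a} E_a) · ↑U₀(b)) (c)` — print's `Q_j(U₀)` applied to the left-invariant field `p̂·U₀`; (§3) so `hH` follows VERBATIM from a right inverse of the
LINEAR map `p ↦ (dIterL j_i ↑U₀ (p̂·U₀) (c_i))_i` from the slice onto `(↑W_i · 𝔰𝔲(2))_i` — [15] (45) «`L^j η Q_j H B = B`» as a statement about `Q`, no derivatives left;
(§4) the lineage's best theorem re-keyed on that letter: ★★★ `hMin_atRecord_of_linearisedAveragingLetters`.

CONTENTS (theorems only; no `def`, no `instance`, no `sorry`).  §1 `expMul_su2Chart_eq_expChart`, `expMul_su2Chart_smul_eq_expChart`, `coe_mul_coe_specialUnitaryAd_inv`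
(`↑g · ↑(Ad(g⁻¹) X) = ↑X · ↑g`).  §2 ★ `hasDerivAt_coe_avgFamily_expMul_smul`.  §3 ★★ `hH_of_dIterL_rightInverse`.  §4 ★★★ `hMin_atRecord_of_linearisedAveragingLetters`.
HONEST SCOPE: chart bookkeeping over NODE 00's calculus; the right inverse itself ([15] (45)–(48): the (J-b) lane), (E), (β), `hcritT`, `hT1u` stay DISPLAYED; nothing of Bałaban's
asserted; count-neutral; N12 NOT discharged; the YM mass gap (Clay) is NOT proved by any of this — R4 closes only the conditional finite-𝕋⁴ rung `BalabanLadder.UV`.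
-/

noncomputable section

namespace Literature.MathematicalPhysics.QuantumFieldTheory.Balaban1983to89.B15Prop1RightInverseFromLinearisedAveraging

open Set Metric Filter
open scoped Topology ComplexConjugate
open Literature.MathematicalPhysics.QuantumFieldTheory.Balaban1983to89.Node00 (SU coeField coeField_apply SmallBelow ConstrSet constrCard constrEnum expChart dIterL
  hasDerivAt_coe_iter_expChart_smul)
open Literature.MathematicalPhysics.QuantumLattice (quatMatrix)
open T4HaarSU2ExpChart (imQuat expPoint)
open T4AdjointCovarianceUnitary (lieSU expSU coe_expSU specialUnitaryAd coe_specialUnitaryAd expSU_specialUnitaryAd)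
open B15AveragingHolomorphic (iterMh)
open B15ComplexifiedDatumFamily (conjVec)
open B15SU2ChartHolomorphic (genE expMulC logCoordC quatMatrix_imQuat)
open B16Ineq19FlatSliceChart (exists_lieSU2Coord expPoint_eq_expSU)
open B15Prop1MinimiserFamilyFromRightInverse (hMin_atRecord_of_rightInverseLetters)
open Literature.MathematicalPhysics.QuantumFieldTheory.BalabanImbrieJaffe1984to88.BIJ85Eq453GaugeField (qsstarGIter0)
open B15Prop1AnalyticExtClause (cplxVec)
open B15Prop1ChartCalculusSU2 (E3)
open B15Prop1ChartSU2 (su2Chart su2Chart_iexp)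
open B15ShellGauge193 (shellGauge)
open B15Extension193 (extend)
open B16Sect1Backgrounds (expMul)
open ExpMeanLog (expMeanLogSU)
open BlockAveraging (blockAvg)
open T4CubeChartGnomonic (SU2)
open T4Continuum B15DeterminingSets GaugeField
open scoped Matrix.Norms.L2Operator

variable {P : Params} {j : ℕ}

/-! ## §1  The chart dictionary: left chart `exp(A)·U₀` = right chart `U₀·exp(Ad_{U₀⁻¹} A)` -/

section Dictionary

variable {φ : EuclideanSpace ℝ (Fin 3) →ₗ[ℝ] lieSU (Fin 2)} (hφ : ∀ v, ((φ v : lieSU (Fin 2)) : Matrix (Fin 2) (Fin 2) ℂ) = quatMatrix (imQuat v))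
include hφ

/-- ★ **THE CHART DICTIONARY AT ANY BASE**: `expMul su2Chart A U₀ = Node00.expChart U₀ (b ↦ Ad((U₀ b)⁻¹)(φ (A b)))` — `exp(Â_b)·U₀,b = U₀,b·exp(U₀,b⁻¹ Â_b U₀,b)`; the case
`U₀ = 1` is `B16Ineq19FlatSliceChart.expMul_su2Chart_one_eq_expChart`. [cite: Balaban1989LargeFieldII, (1.19) p.360; Balaban1989LargeFieldI, (1.74) p.192; Balaban1985BackgroundPropagators, (3.29) p.395] -/
theorem expMul_su2Chart_eq_expChart (A : VecField P j E3) (U₀ : GaugeField P j SU2) :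
    expMul su2Chart A U₀ = expChart U₀ (fun b => specialUnitaryAd (U₀ b)⁻¹ (φ (A b))) := by
  funext b
  show su2Chart.iexp (A b) * U₀ b = U₀ b * expSU (specialUnitaryAd (U₀ b)⁻¹ (φ (A b)))
  rw [su2Chart_iexp, expPoint_eq_expSU hφ, expSU_specialUnitaryAd, inv_inv, ← mul_assoc, ← mul_assoc, mul_inv_cancel, one_mul]

/-- The same along the ray: `expMul su2Chart (s • A) U₀ = Node00.expChart U₀ (s • (b ↦ Ad((U₀ b)⁻¹)(φ (A b))))`. [cite: Balaban1989LargeFieldII, (1.19) p.360 (bookkeeping)] -/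
theorem expMul_su2Chart_smul_eq_expChart (A : VecField P j E3) (U₀ : GaugeField P j SU2) (s : ℝ) :
    expMul su2Chart (s • A) U₀ = expChart U₀ (s • fun b => specialUnitaryAd (U₀ b)⁻¹ (φ (A b))) := by
  rw [expMul_su2Chart_eq_expChart hφ]
  congr 1
  funext b
  simp only [Pi.smul_apply, map_smul]

/-- The right-chart velocity field of the dictionary is the LEFT-invariant field: `↑U₀,b · ↑(Ad((U₀ b)⁻¹)(φ v)) = (Σ_a v_a E_a) · ↑U₀,b`. [cite: Balaban1985Variational, (3)–(4) p.278 (bookkeeping); Balaban1989LargeFieldII, (1.19) p.360] -/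
theorem coe_mul_coe_specialUnitaryAd_inv (g : SU2) (v : EuclideanSpace ℝ (Fin 3)) :
    (g : Matrix (Fin 2) (Fin 2) ℂ) * ((specialUnitaryAd g⁻¹ (φ v) : lieSU (Fin 2)) : Matrix (Fin 2) (Fin 2) ℂ) =
      (∑ a : Fin 3, ((v a : ℝ) : ℂ) • genE a) * (g : Matrix (Fin 2) (Fin 2) ℂ) := by
  rw [coe_specialUnitaryAd, hφ, quatMatrix_imQuat]
  have hinv : ((g⁻¹ : SU2) : Matrix (Fin 2) (Fin 2) ℂ) = star (g : Matrix (Fin 2) (Fin 2) ℂ) := rfl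
  rw [hinv, star_star, ← mul_assoc, ← mul_assoc,
    Unitary.mul_star_self_of_mem (Matrix.specialUnitaryGroup_le_unitaryGroup g.2), one_mul]

end Dictionary

/-! ## §2  The velocity of the multi-scale averages along left-chart lines is `Q_j(U₀)` of the left-invariant field -/

section Velocity

/-- ★ **VELOCITY OF `↑Ū^j(exp(s p̂)·U₀)(c)` AT `s = 0`** (guard below `j` at `U₀`): it is NODE 00's linearised averaging `dIterL j ↑U₀` applied to the left-invariant field
`b ↦ (Σ_a p_{b,a} E_a) · ↑U₀,b` — by the dictionary of §1 and NODE 00's `hasDerivAt_coe_iter_expChart_smul`.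
[cite: Balaban1985Variational, (3) p.278, (44) p.285; Balaban1988Convergent, (2.10)–(2.11) p.256; Balaban1989LargeFieldII, (1.19) p.360] -/
theorem hasDerivAt_coe_avgFamily_expMul_smul {U₀ : GaugeField P 0 SU2} {j : ℕ}
    (hsb : SmallBelow (fun j => blockAvg (P := P) (j := j) expMeanLogSU) j U₀) (p : VecField P 0 E3) (c : PBond P j) :
    HasDerivAt (fun s : ℝ => ((avgFamily (fun j => blockAvg (P := P) (j := j) expMeanLogSU) (expMul su2Chart (s • p) U₀) j c : SU2) : Matrix (Fin 2) (Fin 2) ℂ))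
      (dIterL j (coeField U₀) (fun b => (∑ a : Fin 3, ((p b a : ℝ) : ℂ) • genE a) * ((U₀ b : SU2) : Matrix (Fin 2) (Fin 2) ℂ)) c) 0 := by
  obtain ⟨φ, hφ⟩ := exists_lieSU2Coord
  set X : PBond P 0 → lieSU (Fin 2) := fun b => specialUnitaryAd (U₀ b)⁻¹ (φ (p b)) with hX
  have h := hasDerivAt_coe_iter_expChart_smul (N := 2) hsb X c
  have hvel : (fun b => ((U₀ b : SU 2) : Matrix (Fin 2) (Fin 2) ℂ) * ((X b : lieSU (Fin 2)) : Matrix (Fin 2) (Fin 2) ℂ)) =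
      fun b => (∑ a : Fin 3, ((p b a : ℝ) : ℂ) • genE a) * ((U₀ b : SU2) : Matrix (Fin 2) (Fin 2) ℂ) :=
    funext fun b => coe_mul_coe_specialUnitaryAd_inv hφ (U₀ b) (p b)
  have hfun : (fun s : ℝ => ((avgFamily (fun j => blockAvg (P := P) (j := j) expMeanLogSU) (expMul su2Chart (s • p) U₀) j c : SU2) : Matrix (Fin 2) (Fin 2) ℂ)) =
      fun s : ℝ => ((Averaging.iter (fun j => blockAvg (P := P) (j := j) expMeanLogSU) j (expChart U₀ (s • X)) c : SU 2) : Matrix (Fin 2) (Fin 2) ℂ) := by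
    funext s
    rw [expMul_su2Chart_smul_eq_expChart hφ]
    rfl
  rw [hfun, ← hvel]
  exact h

end Velocity

/-! ## §3  The letter `hH` from a right inverse of the linearised averaging -/

section Letter

/-- ★★ **`hH` FROM A RIGHT INVERSE OF `Q(U₀)` ON THE SLICE.**  If for every target `τ : Fin n → ℝ³` there is a real slice field `p` (`cplxVec p ∈ S`) with
`dIterL j_i ↑U₀ (p̂·U₀) (c_i) = ↑W_i · (Σ_b τ_{i,b} E_b)` at every constrained bond — a RIGHT INVERSE of the LINEAR map «slice → (↑W_i·𝔰𝔲(2))_i, p ↦ (Q_{j_i}(U₀)(p̂·U₀)(c_i))_i»,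
[15] (45) «`L^j η Q_j H B = B`» — then the VELOCITY-currency letter `hH` of `hMin_[atRecord_]of_rightInverseLetters` holds VERBATIM (guard below `k` at `U₀`).
[cite: Balaban1985Variational, Sect. C (44)–(48) p.285; Balaban1988Convergent, (2.10)–(2.11) p.256; Balaban1989LargeFieldII, (1.19) p.360] -/
theorem hH_of_dIterL_rightInverse (𝔹 : DetSet P) (k : ℕ) (W : MSField P SU2) {U₀ : GaugeField P 0 SU2}
    (hsbU : SmallBelow (fun j => blockAvg (P := P) (j := j) expMeanLogSU) k U₀)
    (S : Submodule ℂ (VecField P 0 (EuclideanSpace ℂ (Fin 3))))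
    (hR : ∀ τ : Fin (constrCard 𝔹 k) → EuclideanSpace ℝ (Fin 3), ∃ p : VecField P 0 E3, cplxVec p ∈ S ∧
      ∀ i : Fin (constrCard 𝔹 k), dIterL ((constrEnum 𝔹 k).symm i).1 (coeField U₀)
        (fun b => (∑ a : Fin 3, ((p b a : ℝ) : ℂ) • genE a) * ((U₀ b : SU2) : Matrix (Fin 2) (Fin 2) ℂ)) ((constrEnum 𝔹 k).symm i).2.1 =
        ((W ((constrEnum 𝔹 k).symm i).1 ((constrEnum 𝔹 k).symm i).2.1 : SU2) : Matrix (Fin 2) (Fin 2) ℂ) * ∑ b : Fin 3, ((τ i b : ℝ) : ℂ) • genE b) :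
    ∀ τ : Fin (constrCard 𝔹 k) → EuclideanSpace ℝ (Fin 3), ∃ p : VecField P 0 E3, cplxVec p ∈ S ∧
      ∀ i : Fin (constrCard 𝔹 k), HasDerivAt (fun s : ℝ => ((avgFamily (fun j => blockAvg (P := P) (j := j) expMeanLogSU) (expMul su2Chart (s • p) U₀)
        ((constrEnum 𝔹 k).symm i).1 ((constrEnum 𝔹 k).symm i).2.1 : SU2) : Matrix (Fin 2) (Fin 2) ℂ))
        (((W ((constrEnum 𝔹 k).symm i).1 ((constrEnum 𝔹 k).symm i).2.1 : SU2) : Matrix (Fin 2) (Fin 2) ℂ) * ∑ b : Fin 3, ((τ i b : ℝ) : ℂ) • genE b) 0 := by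
  intro τ
  obtain ⟨p, hpS, hp⟩ := hR τ
  refine ⟨p, hpS, fun i => ?_⟩
  rw [← hp i]
  exact hasDerivAt_coe_avgFamily_expMul_smul (hsbU.mono (Nat.lt_succ_iff.1 ((constrEnum 𝔹 k).symm i).1.2)) p _

end Letter

/-! ## §4  The lineage's best theorem re-keyed on the linearised right inverse -/

section Record

variable {F : T4Family} {k : ℕ}

/-- ★★★ **THE LETTER (J0′) `hMin` AT NODE 00's OBJECTS FROM: a MINIMISER, the guards, a conjugation-stable slice with a RIGHT INVERSE OF THE LINEARISED AVERAGING `Q(U₀)`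
([15] (45), LINEAR currency), (β) for all multipliers, the criticality transfer; and [15] Thm 1's uniqueness clause** — `hMin_atRecord_of_rightInverseLetters` with `hH` discharged by
`hH_of_dIterL_rightInverse`. [cite: Balaban1985Variational, Thm 1 p.279, (3)–(4) p.278, Sect. C (44)–(48) p.285, Sect. F p.300, Sect. G pp.305–307, Prop. 9 (190) p.309; Balaban1989LargeFieldI, (1.74) p.192, Prop. 1 p.194; Balaban1989LargeFieldII, (1.9) p.359, (1.19) p.360; Balaban1988Convergent, (2.10)–(2.12) p.256] -/
theorem hMin_atRecord_of_linearisedAveragingLetters (ν : Node00.Stage7Numerics) (Kt kc : ℕ) (Ω : ℕ → Set (Site (F.P Kt) 0))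
    (Λ : Set (Site (F.P Kt) k)) (lo hi : Fin (F.P Kt).d → ℤ) (𝔹 : DetSet (F.P Kt)) (h𝔹 : ∀ j, k < j → 𝔹 j = ∅)
    (ext : GaugeField (F.P Kt) k SU2 → GaugeField (F.P Kt) k SU2) (hext : ∀ W, ext W = extend Λ (shellGauge W lo hi) W)
    {K : Set (GaugeField (F.P Kt) k SU2)} (hK : IsCompact K) {𝓐₀ : ℝ} (h𝓐₀ : 1 < 𝓐₀)
    (Crit : GaugeField (F.P Kt) 0 SU2 → GaugeField (F.P Kt) 0 SU2 → Prop)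
    (hbase : ∀ Vk ∈ K, ∃ (U₀ : GaugeField (F.P Kt) 0 SU2) (S : Submodule ℂ (VecField (F.P Kt) 0 (EuclideanSpace ℂ (Fin 3))))
        (a : S → ℂ) (Φ₀ : S → Fin (constrCard 𝔹 k) → EuclideanSpace ℂ (Fin 3)),
      IsMinimizer (Node00.avOfRecord F 2 Kt) (Node00.regMSCoPOfRecord F 2 ν Kt kc Ω) 𝔹
        (avgFamily (Node00.avOfRecord F 2 Kt) (qsstarGIter0 k (ext Vk))) U₀ ∧
      SmallBelow (Node00.avOfRecord F 2 Kt) k (qsstarGIter0 k (ext Vk)) ∧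
      SmallBelow (Node00.avOfRecord F 2 Kt) k U₀ ∧
      (∀ X ∈ S, conjVec X ∈ S) ∧
      (∀ X : S, a X = ∑ p : Plaq (F.P Kt) 0, (1 - (expMulC (X : VecField (F.P Kt) 0 (EuclideanSpace ℂ (Fin 3))) (coeField U₀) ⟨p.src, p.μ⟩ *
        expMulC (X : VecField (F.P Kt) 0 (EuclideanSpace ℂ (Fin 3))) (coeField U₀) ⟨p.src.shift p.μ, p.ν⟩ *
        Matrix.adjugate (expMulC (X : VecField (F.P Kt) 0 (EuclideanSpace ℂ (Fin 3))) (coeField U₀) ⟨p.src.shift p.ν, p.μ⟩) *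
        Matrix.adjugate (expMulC (X : VecField (F.P Kt) 0 (EuclideanSpace ℂ (Fin 3))) (coeField U₀) ⟨p.src, p.ν⟩)).trace / 2)) ∧
      (∀ (X : S) i, Φ₀ X i = logCoordC (star ((avgFamily (Node00.avOfRecord F 2 Kt) (qsstarGIter0 k (ext Vk))
        ((constrEnum 𝔹 k).symm i).1 ((constrEnum 𝔹 k).symm i).2.1 : SU2) : Matrix (Fin 2) (Fin 2) ℂ) *
        iterMh ((constrEnum 𝔹 k).symm i).1 (expMulC (X : VecField (F.P Kt) 0 (EuclideanSpace ℂ (Fin 3))) (coeField U₀)) ((constrEnum 𝔹 k).symm i).2.1)) ∧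
      -- DISPLAYED ([15] (45), LINEAR currency): a right inverse of the linearised multi-scale averaging `Q(U₀)` from the slice
      (∀ τ : Fin (constrCard 𝔹 k) → EuclideanSpace ℝ (Fin 3), ∃ p : VecField (F.P Kt) 0 E3, cplxVec p ∈ S ∧
        ∀ i : Fin (constrCard 𝔹 k), dIterL ((constrEnum 𝔹 k).symm i).1 (coeField U₀)
          (fun b => (∑ a : Fin 3, ((p b a : ℝ) : ℂ) • genE a) * ((U₀ b : SU2) : Matrix (Fin 2) (Fin 2) ℂ)) ((constrEnum 𝔹 k).symm i).2.1 =
          ((avgFamily (Node00.avOfRecord F 2 Kt) (qsstarGIter0 k (ext Vk)) ((constrEnum 𝔹 k).symm i).1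
            ((constrEnum 𝔹 k).symm i).2.1 : SU2) : Matrix (Fin 2) (Fin 2) ℂ) * ∑ b : Fin 3, ((τ i b : ℝ) : ℂ) • genE b) ∧
      -- DISPLAYED ((β)): the Lagrange Hessian is nondegenerate on `ker DΦ₀(0)`, for every multiplier of the base state
      (∀ ℓ₀ : (Fin (constrCard 𝔹 k) → EuclideanSpace ℂ (Fin 3)) →L[ℂ] ℂ, fderiv ℂ a 0 = ℓ₀.comp (fderiv ℂ Φ₀ 0) →
        ∀ s : S, fderiv ℂ Φ₀ 0 s = 0 →
          (∀ t : S, fderiv ℂ Φ₀ 0 t = 0 → fderiv ℂ (fderiv ℂ a) 0 s t - ℓ₀ (fderiv ℂ (fderiv ℂ Φ₀) 0 s t) = 0) → s = 0) ∧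
      -- DISPLAYED ([15] Sect. F): criticality transfer
      (∀ᶠ w in 𝓝 ((0 : S), coeField (qsstarGIter0 k (ext Vk))), ∀ (U' Q' : GaugeField (F.P Kt) 0 SU2) (μ : (Fin (constrCard 𝔹 k) → EuclideanSpace ℂ (Fin 3)) →L[ℂ] ℂ),
        expMulC (w.1 : VecField (F.P Kt) 0 (EuclideanSpace ℂ (Fin 3))) (coeField U₀) = coeField U' → coeField Q' = w.2 →
          AgreeOn 𝔹 (avgFamily (Node00.avOfRecord F 2 Kt) U') (avgFamily (Node00.avOfRecord F 2 Kt) Q') →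
          fderiv ℂ a w.1 = μ.comp (fderiv ℂ Φ₀ w.1) → Crit Q' U'))
    (hT1u : ∀ Vk ∈ K, ∀ᶠ Q in 𝓝 (coeField (qsstarGIter0 k (ext Vk))), ∀ U' Q' : GaugeField (F.P Kt) 0 SU2, coeField Q' = Q →
      U' ∈ Node00.regMSCoPOfRecord F 2 ν Kt kc Ω → AgreeOn 𝔹 (avgFamily (Node00.avOfRecord F 2 Kt) U') (avgFamily (Node00.avOfRecord F 2 Kt) Q') →
        Crit Q' U' → IsMinimizer (Node00.avOfRecord F 2 Kt) (Node00.regMSCoPOfRecord F 2 ν Kt kc Ω) 𝔹 (avgFamily (Node00.avOfRecord F 2 Kt) Q') U') :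
    ∃ R : ℝ, 0 < R ∧ ∀ Vk ∈ K,
      ∃ Ũ : VecField (F.P Kt) k (EuclideanSpace ℂ (Fin 3)) × VecField (F.P Kt) k (EuclideanSpace ℂ (Fin 3)) → PBond (F.P Kt) 0 → Matrix (Fin 2) (Fin 2) ℂ,
        (∀ b i j, DifferentiableOn ℂ (fun z => Ũ z b i j) (ball 0 R)) ∧
        (∀ z ∈ ball (0 : VecField (F.P Kt) k (EuclideanSpace ℂ (Fin 3)) × VecField (F.P Kt) k (EuclideanSpace ℂ (Fin 3))) R, ∀ b i j, ‖Ũ z b i j‖ ≤ 𝓐₀) ∧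
        ∀ p B' : VecField (F.P Kt) k E3, ‖p‖ < R → ‖B'‖ < R → ∃ U' : GaugeField (F.P Kt) 0 SU2,
          (∀ b, Ũ (cplxVec p, cplxVec B') b = ((U' b : SU2) : Matrix (Fin 2) (Fin 2) ℂ)) ∧
            IsMinimizer (Node00.avOfRecord F 2 Kt) (Node00.regMSCoPOfRecord F 2 ν Kt kc Ω) 𝔹
              (avgFamily (Node00.avOfRecord F 2 Kt) (qsstarGIter0 k (expMul su2Chart B' (ext (expMul su2Chart p Vk))))) U' :=
  hMin_atRecord_of_rightInverseLetters ν Kt kc Ω Λ lo hi 𝔹 h𝔹 ext hext hK h𝓐₀ Crit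
    (fun Vk hVk => by
      obtain ⟨U₀, S, a, Φ₀, hmin, hsbQ, hsbU, hS, ha, hΦ₀, hR, hnondeg, hcritT⟩ := hbase Vk hVk
      exact ⟨U₀, S, a, Φ₀, hmin, hsbQ, hsbU, hS, ha, hΦ₀, hH_of_dIterL_rightInverse 𝔹 k _ hsbU S hR, hnondeg, hcritT⟩)
    hT1u

end Record

end Literature.MathematicalPhysics.QuantumFieldTheory.Balaban1983to89.B15Prop1RightInverseFromLinearisedAveraging

end
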